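import Summits.QuantumFields.YangMills.Theorems.BalabanUVNodesN22TermPolarizationLocalCauchy
import Literature.MathematicalPhysics.QuantumFieldTheory.Balaban1983to89.Node00.U3OfKernels

/-!
# BalabanUVNodes ∕ node N22 = NE9 — THE FIELD-HESSIAN EXTRACTION COMMUTES WITH A HOLOMORPHIC COUPLING PARAMETER: from ONE jointly holomorphic chart of the windowed
# term functional in (coupling, complexified probe field) to the WINDOWED COUPLING-HOLOMORPHY DATUM displayed by `…N22KernelFadingOfStepRateTwoConstants` — the scalar
# vacuum-polarisation kernel `Π^{(K)}_{k+1}(h|h_m := t; z)` extends holomorphically in `t` with the Cauchy bound `16M R⁻²·Σ‖ιe‖²∕dim` (Track A, DAG node N22 = NE9;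
# cluster K4 «SpineRates»; WIDTH SEAT `pub-ymgap-dag-n22-w1`, harness re-seat g4)

Cell `pub-ymgap`, HUMAN RULING D-0062 (Track A) ∕ D-0149; `--kind proof --supports stmt-QuantumFields-20544 --as helper` (K3⁷ `SpineGivenEndpointR13SepCoPH`), COUNT-NEUTRAL.
THEOREMS ONLY (0 `def`, 0 `sorry`, standard axioms).  Imports dag-n22-c's J28 `…N22TermPolarizationLocalCauchy` (`hasFDerivAt_re_comp`, `contDiffAt_two_of_holomorphic`; through it
lit `HolomorphicBanach` ∕ `SCV` ∕ `HolomorphicParametricIntegral`: `norm_fderiv_fderiv_apply_le`, `differentiableOn_fderiv_apply`, `norm_fderiv_le_of_forall_mem_ball_norm_le`, and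
node00-def's `Node00/BetaOfRecord` (`polScalar`, `polWindow`, `expChart`, `polTensor`)) and `Node00/U3OfKernels` (`histPrefix`) BY NAME.  The producer piece dag-n22-c g14 handed
this seat («the WINDOWED coordinate-holomorphy producer … is YOURS too — it needs the field-Hessian extraction commuting with a holomorphic coupling parameter (joint regularity in
`(t, B)`)», pub-ymgap INBOX l.35590).

WHY.  `…N22KernelFadingOfStepRateTwoConstants` (this seat, CLAIM-2) runs ROAD 3 at the kernel record from a DISPLAYED windowed coupling-holomorphy datum: for each volume index `K`
(eventually), an extension of `t ↦ Π^{(K)}_{k+1}(h|h_m:=t; z) = polWindow F K (k+1) (ℰ k (h|h_m:=t)_{≤k} K) ρ bV μ ν z` to the closed `r`-discs about `]0, γ]`, complex-differentiable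
and bounded.  The windowed kernel is NOT a value of the term functional but the normalised trace of its FIELD HESSIAN at `B = 0` in the chart `B ↦ exp ρB` ([I] (1.20)–(1.21)
p. 264; `polScalar` = `(dim)⁻¹Σ_a ∂²∕∂B^a_μ(x)∂B^a_ν(y)`), so holomorphy in the coupling needs the Hessian extraction to COMMUTE with a holomorphic parameter — true when the chart
is JOINTLY holomorphic in `(t, B)` (print's «𝐄^{(j)} … analytic functions of the effective coupling constants» [I] p. 266 together with the field analyticity of [I] (1.19)–(1.20),
read at finite volume as ONE function on `Dt × ball(0,R)` of the complexified coupling and probe field).  THIS FILE proves exactly that commutation, with the Cauchy bound, and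
the identification at real couplings (the complex Hessian in real directions IS the real kernel — J28's identification for the real part, a reality lemma for the imaginary part).

WHAT (all [folklore]).
* §1 `im_fderiv_apply_eq_zero_of_im_eq_zero` — a holomorphic `G` that is REAL along a real line `s ↦ x₀ + s·v` has `(DG(x₀)·v).im = 0` (`HasDerivAt.real_of_complex` on `−iG`).
* §2 `fderiv_slice_eq`, `differentiableOn_slice`, ★ `hessian_holomorphic_of_joint` — `𝒢` complex-differentiable on the open `Dt × ball(0,R)` with `‖𝒢‖ ≤ M` ⟹ the JOINT mixed
  derivative `τ ↦ ∂_{(0,a)}∂_{(0,b)}𝒢(τ,0)` is holomorphic on `Dt`, equals the slice's field Hessian `∂_a∂_b[𝒢(τ,·)](0)`, and is `≤ 16M R⁻²‖a‖‖b‖` (two Cauchy inequalities).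
* §3 `im_fderiv_apply_eq_zero_of_real_on_image`, ★ `fderiv_fderiv_eq_polTensor` — if `G (ι B) = f B` AS COMPLEX NUMBERS (every real probe field `B`), then
  `∂_{ιe_{x,v}}∂_{ιe_{y,w}}G(0) = Π_f(x,y)(v,w)` in `ℂ` (real part: J28's identification; imaginary part: §1 twice).
* §4 ★★ `exists_holo_polScalar` (a coupling-indexed family of term functionals `ℰt` + ONE joint chart `𝒢` agreeing at real couplings ⟹ `polScalar (ℰt t) ρ bV μ x ν y` extends
  holomorphically to `Dt` with the bound `16M R⁻²(dim)⁻¹Σ_a‖ιe_{x,a}‖‖ιe_{y,a}‖`), ★★★ `windowedCouplingHolo_of_jointChart` — LITERALLY the `hA` binder of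
  `…N22KernelFadingOfStepRateTwoConstants` at `(h, k, μν, z, m, K)` from one joint chart of `B ↦ ℰ k (h|h_m:=t)_{≤k} K (exp ρB)`.
* §5 `exists_exponent_rpow_le` — the consumer's letter row `θ^{1−s} ≤ ω` is met for EVERY `ω ∈ ]θ, 1[` (`s = 1 − log ω∕log θ`): the analytic road books `ℓ.θ₅ < ℓ.ω` only.
READING.  What remains DISPLAYED upstream is now a single object per `(h, m, k, K)`: a jointly holomorphic, bounded chart of the windowed term functional in (coupling `g_m`,
complexified probe field) — the finite-volume conjunction of [I] p. 266's coupling analyticity and (1.19)–(1.20)'s field analyticity; its decay in `|z|₁` (the `B·e^{−κ|z|₁}` of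
the consumer) is the LOCALITY of the localized sum (dag-n22-c's soft-window lineage J27–J36, where the same Cauchy numbers are summed over domains) — not re-typed here.

HONEST FRAMING.  Pure analysis + bookkeeping; count-neutral LOCATED junction; the joint chart is a HYPOTHESIS, asserted nowhere; nothing of Bałaban's constructed; N22 NOT discharged
(typed 28∕28 · discharged 5∕27 UNMOVED — the chair's single count line is the only count); K3⁷ OPEN, NOT claimed, skeleton v5 untouched; one finite four-torus programme at fixed ε —
R4 closes the CONDITIONAL rung `BalabanLadder.UV` only; NOT infinite volume, NOT OS on ℝ⁴, NOT a mass gap, NOT Clay.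

References (TYPES only): [I] = [Balaban1987RG1] T. Bałaban, Commun. Math. Phys. **109** (1987) 249–301 — (1.19)–(1.21) p. 264 («uniformly bounded on the domain (1.19) together
with all derivatives»), §2 p. 266 («analytic functions of the effective coupling constants»); the Banach-space Cauchy inequalities as typed in lit `HolomorphicBanach` ([Chae1985] 13.6, 14.13).
-/

noncomputable section

namespace YMDAG.N22.JointHolo

open Filter Metric Set
open scoped BigOperators Topology
open Literature.MathematicalPhysics.QuantumFieldTheory.Balaban1983to89
open Literature.MathematicalPhysics.QuantumFieldTheory.Balaban1983to89.B12PolarizationTensor120 (polTensor polComp expChart)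
open Literature.Analysis.Complex (norm_fderiv_le_of_forall_mem_ball_norm_le)
open Literature.Analysis.Complex.HolomorphicBanach (norm_fderiv_fderiv_apply_le differentiableOn_fderiv contDiffOn_of_differentiableOn)
open Literature.Analysis.Complex.SCV (differentiableOn_fderiv_apply)
open YMDAG.N22.WindowOfLocalTerms (hasFDerivAt_re_comp contDiffAt_two_of_holomorphic)
open Literature.MathematicalPhysics.QuantumFieldTheory.Balaban1983to89.Node00 (polScalar polWindow siteOfInt TermFamily1)
open Literature.MathematicalPhysics.QuantumFieldTheory.Balaban1983to89.T4Continuum (T4Family)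
open Literature.MathematicalPhysics.QuantumFieldTheory.Balaban1983to89.Node00.U3OfKernels (histPrefix)

/-! ## §1 Reality: a holomorphic function that is real along a real line has a real derivative along it -/

section Reality

variable {Ec : Type*} [NormedAddCommGroup Ec] [NormedSpace ℂ Ec]

/-- **REAL ALONG A REAL LINE ⟹ REAL DERIVATIVE.**  `G` holomorphic on an open `U ∋ x₀`, and `(G (x₀ + s·v)).im = 0` for real `s` near `0` ⟹ `(DG(x₀)·v).im = 0`
(the imaginary part of the section is locally constant, so its derivative `Im(DG(x₀)v)` vanishes). [folklore] -/
theorem im_fderiv_apply_eq_zero_of_im_eq_zero (G : Ec → ℂ) {U : Set Ec} (hG : DifferentiableOn ℂ G U) (hU : IsOpen U) {x₀ : Ec} (hx₀ : x₀ ∈ U)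
    (v : Ec) (hreal : ∀ᶠ s : ℝ in 𝓝 0, (G (x₀ + (s : ℂ) • v)).im = 0) :
    (fderiv ℂ G x₀ v).im = 0 := by
  -- the complex line `w ↦ x₀ + w·v` and the slice of `G` along it
  set φ : ℂ → ℂ := fun w => G (x₀ + w • v) with hφ
  have hlin : HasDerivAt (fun w : ℂ => x₀ + w • v) v 0 := by
    have h := ((hasDerivAt_id' (0 : ℂ)).smul_const v).const_add x₀
    rwa [one_smul] at h
  have hx0 : x₀ + (0 : ℂ) • v = x₀ := by rw [zero_smul, add_zero]
  have hGd : HasFDerivAt G (fderiv ℂ G x₀) (x₀ + (0 : ℂ) • v) := by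
    rw [hx0]; exact (hG.differentiableAt (hU.mem_nhds hx₀)).hasFDerivAt
  have hφd : HasDerivAt φ (fderiv ℂ G x₀ v) 0 := hGd.comp_hasDerivAt (0 : ℂ) hlin
  have hφd0 : HasDerivAt φ (fderiv ℂ G x₀ v) ((0 : ℝ) : ℂ) := by rw [Complex.ofReal_zero]; exact hφd
  -- `Im z = Re (−i z)`: differentiate the real function `s ↦ Re (−i φ(s))` along the reals
  have h2 : HasDerivAt (fun w => -Complex.I * φ w) (-Complex.I * fderiv ℂ G x₀ v) ((0 : ℝ) : ℂ) := hφd0.const_mul _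
  have him : HasDerivAt (fun s : ℝ => (-Complex.I * φ s).re) (-Complex.I * fderiv ℂ G x₀ v).re 0 := h2.real_of_complex
  have hzero : HasDerivAt (fun s : ℝ => (-Complex.I * φ s).re) 0 0 := by
    refine (hasDerivAt_const (0 : ℝ) (0 : ℝ)).congr_of_eventuallyEq ?_
    filter_upwards [hreal] with s hs
    have hs' : (φ s).im = 0 := hs
    show (-Complex.I * φ s).re = 0
    simp [Complex.mul_re, hs']
  have h := him.unique hzero
  simpa [Complex.mul_re] using h

end Reality

/-! ## §2 The Hessian in the field at `B = 0` as a holomorphic function of the coupling parameter -/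

section Extraction

variable {Ec : Type*} [NormedAddCommGroup Ec] [NormedSpace ℂ Ec]

/-- Partial derivative in the field = the joint derivative on `(0, b)`. [folklore] -/
theorem fderiv_slice_eq {𝒢 : ℂ × Ec → ℂ} {W : Set (ℂ × Ec)} (hW : IsOpen W) (h𝒢 : DifferentiableOn ℂ 𝒢 W) {τ : ℂ} {B : Ec}
    (hτB : (τ, B) ∈ W) (b : Ec) :
    fderiv ℂ (fun B' => 𝒢 (τ, B')) B b = fderiv ℂ 𝒢 (τ, B) (0, b) := by
  have h1 : HasFDerivAt 𝒢 (fderiv ℂ 𝒢 (τ, B)) (τ, B) := (h𝒢.differentiableAt (hW.mem_nhds hτB)).hasFDerivAt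
  have h2 : HasFDerivAt (fun B' : Ec => (τ, B')) (ContinuousLinearMap.inr ℂ ℂ Ec) B := hasFDerivAt_prodMk_right τ B
  have h3 : HasFDerivAt (fun B' : Ec => 𝒢 (τ, B')) ((fderiv ℂ 𝒢 (τ, B)).comp (ContinuousLinearMap.inr ℂ ℂ Ec)) B := h1.comp B h2
  rw [h3.fderiv, ContinuousLinearMap.comp_apply, ContinuousLinearMap.inr_apply]

/-- The slice `B ↦ 𝒢 (τ, B)` is holomorphic on the fibre of an open product domain. [folklore] -/
theorem differentiableOn_slice {𝒢 : ℂ × Ec → ℂ} {Dt : Set ℂ} {O : Set Ec} (h𝒢 : DifferentiableOn ℂ 𝒢 (Dt ×ˢ O)) {τ : ℂ} (hτ : τ ∈ Dt) :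
    DifferentiableOn ℂ (fun B => 𝒢 (τ, B)) O :=
  h𝒢.comp ((differentiableOn_const τ).prodMk differentiableOn_id) fun _ hB => ⟨hτ, hB⟩

/-- ★ **THE MIXED FIELD HESSIAN AT `B = 0` IS HOLOMORPHIC IN THE COUPLING PARAMETER, WITH THE CAUCHY BOUND.**  `𝒢 : ℂ × Ec → ℂ` complex-differentiable (jointly) on the
open product `Dt × ball(0, R)` with `‖𝒢‖ ≤ M` there; directions `a, b : Ec`.  Then the JOINT second derivative `τ ↦ ∂_{(0,a)}∂_{(0,b)}𝒢(τ, 0)` is holomorphic on `Dt`, equals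
the field Hessian `∂_a∂_b[𝒢(τ, ·)](0)` of the slice at every `τ ∈ Dt`, and is bounded by `16M R⁻² ‖a‖ ‖b‖` (two Cauchy inequalities, `HolomorphicBanach` BY NAME — the same
numbers as J28's `abs_polTensor_le_of_holomorphic`). [folklore] -/
theorem hessian_holomorphic_of_joint {Dt : Set ℂ} (hDt : IsOpen Dt) {R M : ℝ} (hR : 0 < R) (𝒢 : ℂ × Ec → ℂ)
    (h𝒢 : DifferentiableOn ℂ 𝒢 (Dt ×ˢ ball (0 : Ec) R)) (hM : ∀ p ∈ Dt ×ˢ ball (0 : Ec) R, ‖𝒢 p‖ ≤ M) (a b : Ec) :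
    DifferentiableOn ℂ (fun τ => fderiv ℂ (fun p => fderiv ℂ 𝒢 p (0, b)) (τ, 0) (0, a)) Dt ∧
    ∀ τ ∈ Dt,
      fderiv ℂ (fun p => fderiv ℂ 𝒢 p (0, b)) (τ, 0) (0, a) = fderiv ℂ (fun B => fderiv ℂ (fun B' => 𝒢 (τ, B')) B b) 0 a ∧
      ‖fderiv ℂ (fun B => fderiv ℂ (fun B' => 𝒢 (τ, B')) B b) 0 a‖ ≤ 16 * M / R ^ 2 * ‖a‖ * ‖b‖ := by
  set W : Set (ℂ × Ec) := Dt ×ˢ ball (0 : Ec) R with hWdef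
  have hW : IsOpen W := hDt.prod isOpen_ball
  have h0 : (0 : Ec) ∈ ball (0 : Ec) R := mem_ball_self hR
  -- the joint first and second derivatives along `(0, b)` and `(0, a)` are holomorphic on `W`
  set Ψ : ℂ × Ec → ℂ := fun p => fderiv ℂ 𝒢 p (0, b) with hΨ
  have hΨd : DifferentiableOn ℂ Ψ W := differentiableOn_fderiv_apply h𝒢 hW (0, b)
  have hΞd : DifferentiableOn ℂ (fun p => fderiv ℂ Ψ p (0, a)) W := differentiableOn_fderiv_apply hΨd hW (0, a)
  have hemb : DifferentiableOn ℂ (fun τ : ℂ => (τ, (0 : Ec))) Dt := (differentiableOn_id.prodMk (differentiableOn_const _))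
  refine ⟨hΞd.comp hemb fun τ hτ => ⟨hτ, h0⟩, fun τ hτ => ?_⟩
  have hτ0 : (τ, (0 : Ec)) ∈ W := ⟨hτ, h0⟩
  -- the slice and its holomorphy on the ball
  have hG : DifferentiableOn ℂ (fun B => 𝒢 (τ, B)) (ball (0 : Ec) R) := differentiableOn_slice h𝒢 hτ
  -- (i) the partial Hessian equals the joint one
  have hfib : {B : Ec | (τ, B) ∈ W} ∈ 𝓝 (0 : Ec) :=
    (continuous_const.prodMk continuous_id).continuousAt.preimage_mem_nhds (hW.mem_nhds hτ0)
  have hev : (fun B => fderiv ℂ (fun B' => 𝒢 (τ, B')) B b) =ᶠ[𝓝 0] fun B => Ψ (τ, B) :=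
    Filter.mem_of_superset hfib fun B hB => fderiv_slice_eq hW h𝒢 hB b
  have heq : fderiv ℂ (fun p => fderiv ℂ 𝒢 p (0, b)) (τ, 0) (0, a) = fderiv ℂ (fun B => fderiv ℂ (fun B' => 𝒢 (τ, B')) B b) 0 a := by
    rw [hev.fderiv_eq, fderiv_slice_eq hW hΨd hτ0 a]
  refine ⟨heq, ?_⟩
  -- (ii) the two Cauchy inequalities on the slice
  have hK : ∀ y ∈ ball (0 : Ec) (R / 2), ‖fderiv ℂ (fun B => 𝒢 (τ, B)) y‖ ≤ 4 * M / R := by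
    intro y hy
    have hsub : ball y (R / 2) ⊆ ball (0 : Ec) R := by
      intro y' hy'
      rw [mem_ball_zero_iff]
      rw [mem_ball, dist_eq_norm] at hy'
      rw [mem_ball_zero_iff] at hy
      calc ‖y'‖ = ‖(y' - y) + y‖ := by rw [sub_add_cancel]
        _ ≤ ‖y' - y‖ + ‖y‖ := norm_add_le _ _
        _ < R / 2 + R / 2 := add_lt_add hy' hy
        _ = R := by ring
    have h := norm_fderiv_le_of_forall_mem_ball_norm_le (half_pos hR) (hG.mono hsub) fun y' hy' => hM (τ, y') ⟨hτ, hsub hy'⟩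
    calc ‖fderiv ℂ (fun B => 𝒢 (τ, B)) y‖ ≤ 2 * M / (R / 2) := h
      _ = 4 * M / R := by field_simp; ring
  have hball : ball (0 : Ec) (R / 2) ⊆ ball (0 : Ec) R := ball_subset_ball (by linarith)
  have h2 := norm_fderiv_fderiv_apply_le hG isOpen_ball (half_pos hR) hball hK b
  calc ‖fderiv ℂ (fun B => fderiv ℂ (fun B' => 𝒢 (τ, B')) B b) 0 a‖
      ≤ ‖fderiv ℂ (fun B => fderiv ℂ (fun B' => 𝒢 (τ, B')) B b) 0‖ * ‖a‖ := ContinuousLinearMap.le_opNorm _ _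
    _ ≤ 2 * (4 * M / R) / (R / 2) * ‖b‖ * ‖a‖ := mul_le_mul_of_nonneg_right h2 (norm_nonneg _)
    _ = 16 * M / R ^ 2 * ‖a‖ * ‖b‖ := by field_simp; ring

end Extraction

/-! ## §3 At a REAL coupling: the complex field Hessian in real directions IS the real polarization kernel (J28's identification + §1's reality) -/

section Identify

variable {Ec : Type*} [NormedAddCommGroup Ec] [NormedSpace ℂ Ec]
  {P : Type*} [NormedAddCommGroup P] [NormedSpace ℝ P]

/-- If `G` is REAL on the image of the real probe space (`G (ι B) = φ B` as complex numbers, every `B`), its derivative at `ι B` in a real direction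
`ι e` is real (§1 along the line `s ↦ ι(B + s·e)`). [folklore] -/
theorem im_fderiv_apply_eq_zero_of_real_on_image (G : Ec → ℂ) {U : Set Ec} (hG : DifferentiableOn ℂ G U) (hU : IsOpen U) (ι : P →L[ℝ] Ec)
    (φ : P → ℝ) (hreal : ∀ B, G (ι B) = (φ B : ℂ)) {B : P} (hB : ι B ∈ U) (e : P) :
    (fderiv ℂ G (ι B) (ι e)).im = 0 := by
  refine im_fderiv_apply_eq_zero_of_im_eq_zero G hG hU hB (ι e) (Filter.Eventually.of_forall fun s => ?_)
  have e1 : ι B + (s : ℂ) • ι e = ι (B + s • e) := by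
    rw [map_add, map_smul, Complex.coe_smul]
  rw [e1, hreal, Complex.ofReal_im]

variable {Λ T V : Type*} [Fintype Λ] [Fintype T] [DecidableEq Λ] [DecidableEq T] [NormedAddCommGroup V] [NormedSpace ℝ V]

/-- ★ **THE COMPLEX FIELD HESSIAN IN REAL DIRECTIONS IS THE REAL POLARIZATION KERNEL.**  `G` holomorphic on an open `U ⊇ ball 0 R` of the complexified probe space,
`ι` the real-linear embedding of the probe fields, and the real functional `f` with `f B = G (ι B)` AS COMPLEX NUMBERS (every `B`): then for all sites and colour directions
`∂_{ιe_{x,v}}∂_{ιe_{y,w}} G (0) = Π_f(x,y)(v,w)` in `ℂ` — the real part is J28's identification (`hasFDerivAt_re_comp` twice), the imaginary part vanishes by §1 applied to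
`G` and to `z ↦ DG(z)·ιe_{y,w}`. [folklore] -/
theorem fderiv_fderiv_eq_polTensor (G : Ec → ℂ) {U : Set Ec} (hG : DifferentiableOn ℂ G U) (hU : IsOpen U) {R : ℝ} (hR : 0 < R) (hRU : ball (0 : Ec) R ⊆ U)
    (ι : (Λ → T → V) →L[ℝ] Ec) (f : (Λ → T → V) → ℝ) (hf : ∀ B, G (ι B) = (f B : ℂ))
    (μ : Λ) (x : T) (v : V) (ν : Λ) (y : T) (w : V) :
    fderiv ℂ (fun z => fderiv ℂ G z (ι (Pi.single ν (Pi.single y w)))) 0 (ι (Pi.single μ (Pi.single x v)))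
      = ((polTensor ℝ f μ x v ν y w : ℝ) : ℂ) := by
  set e₁ : Λ → T → V := Pi.single μ (Pi.single x v) with he₁
  set e₂ : Λ → T → V := Pi.single ν (Pi.single y w) with he₂
  set a : Ec := ι e₁ with ha
  set b : Ec := ι e₂ with hb
  have hfre : ∀ B, f B = (G (ι B)).re := fun B => by rw [hf B, Complex.ofReal_re]
  have hι0 : ι 0 ∈ U := by rw [map_zero]; exact hRU (mem_ball_self hR)
  -- the first field derivative `gw z = DG(z)·b` is holomorphic and REAL on the image of the real probe space near `0`
  set gw : Ec → ℂ := fun z => fderiv ℂ G z b with hgw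
  have hgw_holo : DifferentiableOn ℂ gw U := differentiableOn_fderiv_apply hG hU b
  have hpre : ι ⁻¹' U ∈ 𝓝 (0 : Λ → T → V) := ι.continuous.continuousAt.preimage_mem_nhds (hU.mem_nhds hι0)
  -- REAL PART (J28): the real kernel is `Re ∂_a ∂_b G (0)`
  have hre : polTensor ℝ f μ x v ν y w = (fderiv ℂ gw 0 a).re := by
    have hfun : f = fun B => (G (ι B)).re := funext hfre
    have hD1 : ∀ B : Λ → T → V, ι B ∈ U → fderiv ℝ f B e₂ = (gw (ι B)).re := by
      intro B hBU
      rw [hfun, (hasFDerivAt_re_comp G hG hU ι hBU).fderiv]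
      rfl
    have hev : (fun B => fderiv ℝ f B e₂) =ᶠ[𝓝 0] fun B => (gw (ι B)).re :=
      Filter.mem_of_superset hpre fun B hBU => hD1 B hBU
    have hC2 : ContDiffAt ℝ 2 f 0 := by rw [hfun]; exact contDiffAt_two_of_holomorphic G hG hU ι hι0
    have hd : DifferentiableAt ℝ (fderiv ℝ f) 0 :=
      (hC2.fderiv_right (m := 1) le_rfl).differentiableAt one_ne_zero
    simp only [polTensor]
    have h := fderiv_clm_apply hd (differentiableAt_const e₂)
    rw [fderiv_fun_const] at h
    simp only [Pi.zero_apply, ContinuousLinearMap.comp_zero, zero_add] at h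
    have h' := congrArg (fun L : (Λ → T → V) →L[ℝ] ℝ => L e₁) h
    simp only [ContinuousLinearMap.flip_apply] at h'
    rw [← he₁, ← he₂, ← h', hev.fderiv_eq, (hasFDerivAt_re_comp gw hgw_holo hU ι hι0).fderiv]
    simp only [ContinuousLinearMap.coe_comp, Function.comp_apply, ContinuousLinearMap.coe_restrictScalars', Complex.reCLM_apply, map_zero]
    rfl
  -- IMAGINARY PART (§1 twice): `gw` is real on the image of the real probe space near `0`, hence `∂_a gw (0)` is real
  have him : (fderiv ℂ gw 0 a).im = 0 := by
    have hgw_real : ∀ᶠ s : ℝ in 𝓝 0, (gw ((0 : Ec) + (s : ℂ) • a)).im = 0 := by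
      have hcont : Continuous fun s : ℝ => s • e₁ := continuous_id.smul continuous_const
      have hline : Tendsto (fun s : ℝ => s • e₁) (𝓝 0) (𝓝 0) := by
        simpa using (hcont.tendsto 0)
      filter_upwards [hline.eventually hpre] with s hs
      have eq1 : (0 : Ec) + (s : ℂ) • a = ι (s • e₁) := by
        rw [ha, map_smul, Complex.coe_smul, zero_add]
      rw [eq1]
      exact im_fderiv_apply_eq_zero_of_real_on_image G hG hU ι f hf hs e₂
    exact im_fderiv_apply_eq_zero_of_im_eq_zero gw hgw_holo hU (x₀ := 0) (by rw [← map_zero ι]; exact hι0) a hgw_real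
  apply Complex.ext
  · rw [Complex.ofReal_re, hre]
  · rw [Complex.ofReal_im, him]

end Identify

/-! ## §4 THE WINDOWED COUPLING-HOLOMORPHY DATUM: the scalar kernel `polScalar` ∕ the windowed kernel `polWindow` of a coupling-indexed family of term functionals
extends holomorphically in the coupling, with the Cauchy bound, from ONE jointly holomorphic chart -/

section Window

variable {Ec : Type*} [NormedAddCommGroup Ec] [NormedSpace ℂ Ec]
variable {𝔄 : Type*} [NormedRing 𝔄] [NormedAlgebra ℝ 𝔄]
variable {V : Type*} [NormedAddCommGroup V] [NormedSpace ℝ V] {ι' : Type*} [Fintype ι']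
variable {Λ T : Type*} [Fintype Λ] [Fintype T] [DecidableEq Λ] [DecidableEq T]

/-- ★★ **THE SCALAR KERNEL OF A COUPLING-INDEXED FAMILY EXTENDS HOLOMORPHICALLY IN THE COUPLING.**  `ℰt t` the term functional at the real coupling `t`, read in the chart
`B ↦ ℰt t (exp ρB)`; ONE function `𝒢 : ℂ × Ec → ℂ` complex-differentiable on the open product `Dt × ball(0,R)` with `‖𝒢‖ ≤ M`, AGREEING with the charts at real couplings
through a real-linear embedding `ι` of the probe fields (`𝒢 (t, ι B) = ℰt t (exp ρB)` for `t ∈ ]0,γ]`, all `B`) ⟹ `Fc τ := (dim)⁻¹ Σ_a ∂_{(0,ιe_{x,a})}∂_{(0,ιe_{y,a})}𝒢(τ, 0)` is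
holomorphic on `Dt`, bounded by `16M R⁻²·(dim)⁻¹Σ_a ‖ιe_{x,a}‖‖ιe_{y,a}‖`, and equals `polScalar (ℰt t) ρ bV μ x ν y` at every real `t ∈ ]0,γ]` (§2 + §3). [folklore] -/
theorem exists_holo_polScalar (ρ : V →L[ℝ] 𝔄) (bV : Module.Basis ι' ℝ V) (ℰt : ℝ → ((Λ → T → 𝔄) → ℝ))
    {Dt : Set ℂ} (hDt : IsOpen Dt) {R M γ : ℝ} (hR : 0 < R) (𝒢 : ℂ × Ec → ℂ)
    (h𝒢 : DifferentiableOn ℂ 𝒢 (Dt ×ˢ ball (0 : Ec) R)) (hM : ∀ p ∈ Dt ×ˢ ball (0 : Ec) R, ‖𝒢 p‖ ≤ M)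
    (ι : (Λ → T → V) →L[ℝ] Ec) (hreal : ∀ t ∈ Ioc (0 : ℝ) γ, (t : ℂ) ∈ Dt)
    (hf : ∀ t ∈ Ioc (0 : ℝ) γ, ∀ B, 𝒢 (t, ι B) = ((expChart (ℰt t) ρ B : ℝ) : ℂ)) (μ : Λ) (x : T) (ν : Λ) (y : T) :
    ∃ Fc : ℂ → ℂ, DifferentiableOn ℂ Fc Dt ∧
      (∀ τ ∈ Dt, ‖Fc τ‖ ≤ 16 * M / R ^ 2 *
        ((Fintype.card ι' : ℝ)⁻¹ * ∑ a, ‖ι (Pi.single μ (Pi.single x (bV a)))‖ * ‖ι (Pi.single ν (Pi.single y (bV a)))‖)) ∧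
      (∀ t ∈ Ioc (0 : ℝ) γ, Fc t = ((polScalar (ℰt t) ρ bV μ x ν y : ℝ) : ℂ)) := by
  set e₁ : ι' → Ec := fun a => ι (Pi.single μ (Pi.single x (bV a))) with he₁
  set e₂ : ι' → Ec := fun a => ι (Pi.single ν (Pi.single y (bV a))) with he₂
  set H : ι' → ℂ → ℂ := fun a τ => fderiv ℂ (fun p => fderiv ℂ 𝒢 p (0, e₂ a)) (τ, 0) (0, e₁ a) with hH
  have hHa := fun a => hessian_holomorphic_of_joint hDt hR 𝒢 h𝒢 hM (e₁ a) (e₂ a)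
  refine ⟨fun τ => ((Fintype.card ι' : ℝ)⁻¹ : ℂ) * ∑ a, H a τ, ?_, ?_, ?_⟩
  · -- holomorphy: a finite sum of the §2 functions
    refine (DifferentiableOn.const_mul ?_ _)
    have hfun : (fun τ => ∑ a, H a τ) = ∑ a, H a := by
      funext τ; simp only [Finset.sum_apply]
    rw [hfun]
    exact DifferentiableOn.sum fun a _ => (hHa a).1
  · -- the Cauchy bound, summand by summand
    intro τ hτ
    have hsum : ‖∑ a, H a τ‖ ≤ ∑ a, 16 * M / R ^ 2 * ‖e₁ a‖ * ‖e₂ a‖ := by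
      refine (norm_sum_le _ _).trans (Finset.sum_le_sum fun a _ => ?_)
      have h := (hHa a).2 τ hτ
      rw [hH]; dsimp only
      rw [h.1]
      exact h.2
    have hcard : 0 ≤ (Fintype.card ι' : ℝ)⁻¹ := inv_nonneg.2 (Nat.cast_nonneg _)
    rw [norm_mul, norm_inv, Complex.norm_real, Real.norm_natCast]
    rw [Finset.mul_sum]
    calc (Fintype.card ι' : ℝ)⁻¹ * ‖∑ a, H a τ‖ ≤ (Fintype.card ι' : ℝ)⁻¹ * ∑ a, 16 * M / R ^ 2 * ‖e₁ a‖ * ‖e₂ a‖ :=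
          mul_le_mul_of_nonneg_left hsum hcard
      _ = 16 * M / R ^ 2 * ∑ a, (Fintype.card ι' : ℝ)⁻¹ * (‖e₁ a‖ * ‖e₂ a‖) := by
          rw [Finset.mul_sum, Finset.mul_sum]
          exact Finset.sum_congr rfl fun a _ => by ring
  · -- agreement with the real scalar kernel at real couplings
    intro t ht
    have hG : DifferentiableOn ℂ (fun B => 𝒢 ((t : ℂ), B)) (ball (0 : Ec) R) := differentiableOn_slice h𝒢 (hreal t ht)
    have hterm : ∀ a, H a t = ((polTensor ℝ (expChart (ℰt t) ρ) μ x (bV a) ν y (bV a) : ℝ) : ℂ) := by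
      intro a
      rw [hH]; dsimp only
      rw [((hHa a).2 (t : ℂ) (hreal t ht)).1]
      exact fderiv_fderiv_eq_polTensor (fun B => 𝒢 ((t : ℂ), B)) hG isOpen_ball hR subset_rfl ι (expChart (ℰt t) ρ) (hf t ht)
        μ x (bV a) ν y (bV a)
    simp only [polScalar, polComp, hterm]
    push_cast
    rfl

/-- ★★★ **THE WINDOWED COUPLING-HOLOMORPHY DATUM OF `…N22KernelFadingOfStepRateTwoConstants` FROM ONE JOINT CHART PER VOLUME INDEX.**  For a term family `ℰ`, a base history
`h`, a young coupling `m`, a level `k`, a volume index `K` and a kernel entry `(μν, z)`: ONE function `𝒢 : ℂ × Ec → ℂ`, complex-differentiable on the open product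
`Dt × ball(0,R)` (`Dt ⊇` the closed `r`-discs about `]0, γ]`) with `‖𝒢‖ ≤ M`, agreeing at real couplings with the charts `B ↦ ℰ k (h|h_m:=t)_{≤k} K (exp ρB)` through a
real-linear embedding `ι` of the probe fields, and a constant `Bd ≥ 16M R⁻²·(dim)⁻¹Σ_a‖ιe_{μ,z,a}‖‖ιe_{ν,0,a}‖` ⟹ the DISPLAYED binder `hA` of the kernel-fading road at
`(h, k, μν, z, m, K)`: `∃ Fc D, holomorphic ∧ ‖Fc‖ ≤ Bd on D ∧ r-discs ⊆ D ∧ Fc t = Π^{(K)}_{k+1}(h|h_m:=t; z)` — «the field-Hessian extraction commutes with a holomorphic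
coupling parameter» (joint regularity in `(t, B)`, as dag-n22-c located it, pub-ymgap INBOX l.35590). [folklore] -/
theorem windowedCouplingHolo_of_jointChart (F : T4Family) (ℰ : TermFamily1 F 𝔄) (ρ : V →L[ℝ] 𝔄) (bV : Module.Basis ι' ℝ V)
    (h : ℕ → ℝ) (m k K : ℕ) (μ ν : Fin 4) (z : Fin 4 → ℤ)
    {Dt : Set ℂ} (hDt : IsOpen Dt) {R M γ r Bd : ℝ} (hR : 0 < R) (hr : 0 ≤ r) (𝒢 : ℂ × Ec → ℂ)
    (h𝒢 : DifferentiableOn ℂ 𝒢 (Dt ×ˢ ball (0 : Ec) R)) (hM : ∀ p ∈ Dt ×ˢ ball (0 : Ec) R, ‖𝒢 p‖ ≤ M)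
    (ι : (Fin (F.P K).d → Site (F.P K) (k + 1) → V) →L[ℝ] Ec) (hdisc : ∀ t ∈ Ioc (0 : ℝ) γ, closedBall (t : ℂ) r ⊆ Dt)
    (hf : ∀ t ∈ Ioc (0 : ℝ) γ, ∀ B, 𝒢 (t, ι B) = ((expChart (ℰ k (histPrefix (Function.update h m t) k) K) ρ B : ℝ) : ℂ))
    (hBd : 16 * M / R ^ 2 * ((Fintype.card ι' : ℝ)⁻¹ *
      ∑ a, ‖ι (Pi.single (Fin.cast (F.P_d K).symm μ) (Pi.single (siteOfInt F K (k + 1) z) (bV a)))‖ *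
        ‖ι (Pi.single (Fin.cast (F.P_d K).symm ν) (Pi.single (siteOfInt F K (k + 1) 0) (bV a)))‖) ≤ Bd) :
    ∃ (Fc : ℂ → ℂ) (D : Set ℂ), DifferentiableOn ℂ Fc D ∧ (∀ w ∈ D, ‖Fc w‖ ≤ Bd) ∧
      (∀ t ∈ Ioc (0 : ℝ) γ, closedBall (t : ℂ) r ⊆ D) ∧
      (∀ t ∈ Ioc (0 : ℝ) γ, Fc t = (polWindow F K (k + 1) (ℰ k (histPrefix (Function.update h m t) k) K) ρ bV μ ν z : ℂ)) := by
  have hreal : ∀ t ∈ Ioc (0 : ℝ) γ, (t : ℂ) ∈ Dt := fun t ht => hdisc t ht (mem_closedBall_self hr)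
  obtain ⟨Fc, hFc, hbd, hagree⟩ := exists_holo_polScalar ρ bV (fun t => ℰ k (histPrefix (Function.update h m t) k) K) hDt hR 𝒢 h𝒢 hM ι hreal hf
    (Fin.cast (F.P_d K).symm μ) (siteOfInt F K (k + 1) z) (Fin.cast (F.P_d K).symm ν) (siteOfInt F K (k + 1) 0)
  exact ⟨Fc, Dt, hFc, fun w hw => (hbd w hw).trans hBd, hdisc, fun t ht => hagree t ht⟩

end Window


/-! ## §5 RIDER FOR THE CONSUMER's LETTER ROWS: on the analytic road every `ℓ.ω ∈ ]ℓ.θ₅, 1[` is admissible -/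

section Rows

/-- **THE ROW `θ^{1−s} ≤ ω` IS MET FOR EVERY `ω ∈ ]θ, 1[`** (`0 < θ`): take `s = 1 − log ω ∕ log θ ∈ ]0, 1[`, for which `θ^{1−s} = ω` exactly.  So the letter rows of
`…N22KernelFadingOfStepRateTwoConstants` §2 (`0 < s < 1`, `ℓ.θ₅^{1−s} ≤ ℓ.ω`, then `ℓ.C₉ ≥ C₉(s)`) are jointly satisfiable with `U3Letters₁₁.Signs` for ANY fading rate strictly
between node N18's `ℓ.θ₅` and `1` — the analytic road books `ℓ.θ₅ < ℓ.ω`, nothing more. [folklore] -/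
theorem exists_exponent_rpow_le {θ ω : ℝ} (hθ0 : 0 < θ) (hθω : θ < ω) (hω1 : ω < 1) :
    ∃ s : ℝ, 0 < s ∧ s < 1 ∧ θ ^ (1 - s) ≤ ω := by
  have hω0 : 0 < ω := hθ0.trans hθω
  have hlθ : Real.log θ < 0 := Real.log_neg hθ0 (hθω.trans hω1)
  have hlω : Real.log ω < 0 := Real.log_neg hω0 hω1
  have hlt : Real.log θ < Real.log ω := Real.log_lt_log hθ0 hθω
  refine ⟨1 - Real.log ω / Real.log θ, ?_, ?_, le_of_eq ?_⟩
  · -- `log ω / log θ < 1`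
    have h : Real.log ω / Real.log θ < 1 := by
      rw [div_lt_one_of_neg hlθ]; exact hlt
    linarith
  · -- `0 < log ω / log θ`
    have h : 0 < Real.log ω / Real.log θ := div_pos_of_neg_of_neg hlω hlθ
    linarith
  · rw [sub_sub_cancel, Real.rpow_def_of_pos hθ0, mul_div_cancel₀ _ hlθ.ne, Real.exp_log hω0]

end Rows

end YMDAG.N22.JointHolo

end
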